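import Mathlib
import Summits.Ventures.HodgeRepro2.T6N5Hyp
import Summits.Ventures.HodgeRepro2.T6N5Datum

/-!
# T6N5Main — N5 from its displays (the owner theorem of TARGET-T6 v0.4 §9.3, row N5, modulo the
lead's composition carrier `NAut`)

Tier 6 (README §10), sub-step N5 (t6-p7 with t6-p8).  `N5_main_exists` / `N5_main_fixed` are N5 for
the datum `N : N5Datum.Datum` from the DISPLAYS of T6N5Hyp consumed BY NAME — Theorem 5.6 (class PO),
Hsieh's Theorem A, Burungale–Hida's Theorem B, Hsieh's (1.1) (class AC) — plus the kernel-side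
hypotheses that the composition discharges from the datum's construction and kernel theorems:
`N5Main.KernelHyps` (the non-display fields of `GBranch.Hyps`: the local μ-invariants are finite,
the root number is +1, the twist step, μ < ⊤ ⇒ measure ≠ 0, Weierstrass), N5.L1 (`levelReduction`,
from `T6N5Level` on the representation carrier), (a) (from the definition of β′ and S-H), and (b)
(from t6-p8's local half / the real-place residual).  The final `N5_main (P) (M) … : M.iiA ∧ M.iiB`
of §9.3 is the 5-line wrapper of these through `N5Data.assembly_ii` once `NAut` is in tree (d5 :=
`N5Datum.Datum`, compat «M.iiA = M.d5.current.A.levelPeriodNonzero ∧ …B»).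

§8(d): uses an L-value-free non-vanishing device: NO.
-/

namespace Summit.Ventures.HodgeRepro2.T6.N5Main

open Summit.Ventures.HodgeRepro2.T6.N5Skeleton Summit.Ventures.HodgeRepro2.T6.N5PropG
  Summit.Ventures.HodgeRepro2.T6.N5Family Summit.Ventures.HodgeRepro2.T6.N5Datum
  Summit.Ventures.HodgeRepro2.T6.Hyp

/-- The NON-DISPLAY hypotheses of a Proposition-G branch (TIER5 §G S1–S5's [A]-steps): every field is
discharged at the composition by a kernel theorem on the datum's construction — `local_finite` by
p7's `T5PropGArithmetic.local_mu_lt_top` (v | ℭ⁻ ⇒ χ_v ≠ 1), `sign` by `N5Signs.rsign_of_condB` +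
B1's Hilbert reciprocity (= (R-sign), §N5.5(c)), `twist` by `mu_twist_invariant` ([A-3]), `nonzero`
by `mu_eq_top_iff` (S1), `finite_of_nonzero` by p7's `T5PropGBranchMeasure.finitelyManyZeros_branchData`
(S5, Weierstrass in kernel).  No printed statement is among them. -/
structure KernelHyps {ι Ξ K : Type*} [Field K] (b : GBranch ι Ξ K) : Prop where
  /-- S4 [A]: each local invariant μ_p(χ_v), v | ℭ⁻, is finite. -/
  local_finite : ∀ v ∈ b.condMinus, b.muLoc v < ⊤
  /-- (R-sign): the root number of the branch is +1. -/
  sign : b.rootNumber = 1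
  /-- [A-3]: the λ⁻¹-branch and the χ-branch have the same μ-invariant on Γ^-. -/
  twist : b.muBH = b.muHsieh
  /-- S1 [A]: finite μ-invariant ⇒ non-zero 𝔭-line measure. -/
  nonzero : b.muBHp < ⊤ → b.measureNeZero
  /-- S5: a non-zero 𝔭-line measure kills only finitely many twists. -/
  finite_of_nonzero : b.measureNeZero → T5PropGSkeleton.FinitelyManyZeros b.toBranchData

/-- `GBranch.Hyps` from the three displays consumed BY NAME and the kernel-side hypotheses. -/
theorem hyps_of {ι Ξ K : Type*} [Field K] {b : GBranch ι Ξ K}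
    (hHs : Hsieh2014mu_ThmA b) (hBH : BurungaleHida2017_ThmB b) (hInt : Hsieh2014mu_Interp1_1 b)
    (hk : KernelHyps b) : b.Hyps where
  hsieh := hHs
  local_finite := hk.local_finite
  sign := hk.sign
  twist := hk.twist
  bh := hBH
  nonzero := hk.nonzero
  finite_of_nonzero := hk.finite_of_nonzero
  interp := hInt

variable {ι G Ξ ι' K : Type*} [CommGroup G] [Field K] (N : Datum ι G Ξ ι' K)

/-- The two sides of every member of the datum's twist family — the set `S` on which Theorem 5.6's
display is consumed (non-empty: it contains the datum's own sides). -/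
def sides : Set (ToricSide ι G) :=
  Set.range (fun ν => (N.D ν).A) ∪ Set.range (fun ν => (N.D ν).B)

/-- Side A of every member is in `sides`. -/
theorem A_mem_sides (ν : Ξ) : (N.D ν).A ∈ sides N := Or.inl ⟨ν, rfl⟩

/-- Side B of every member is in `sides`. -/
theorem B_mem_sides (ν : Ξ) : (N.D ν).B ∈ sides N := Or.inr ⟨ν, rfl⟩

/-- The datum's own side A is in `sides`. -/
theorem current_A_mem_sides : N.current.A ∈ sides N := A_mem_sides N N.ν

/-- The datum's own side B is in `sides`. -/
theorem current_B_mem_sides : N.current.B ∈ sides N := B_mem_sides N N.ν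

/-- `sides` is non-empty (README §10.5(ii)(b): the display on `S = ∅` would be vacuous). -/
theorem sides_nonempty : (sides N).Nonempty := ⟨_, current_A_mem_sides N⟩

/-- N5 FOR THE FIXED DATUM FROM THE DISPLAYS: Theorem 5.6 (by name, on `sides`), N5.L1, (a), (b) and
(c) at the datum's twist give N5 — the shape of `N5_main` with (c) the EX-class binder. -/
theorem N5_main_fixed (hT : BFGYYZ2025_Thm5_6 (sides N))
    (hL : N.current.A.levelReduction ∧ N.current.B.levelReduction)
    (ha : N.current.A.condA ∧ N.current.B.condA) (hb : N.current.A.condB ∧ N.current.B.condB)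
    (hc : N.current.condC) : N.N5 :=
  N.N5_of_condC ⟨hT _ (current_A_mem_sides N), hT _ (current_B_mem_sides N)⟩ hL ha hb hc

/-- (c) AT THE DATUM'S TWIST FROM THE §G DISPLAYS: if the datum's twist avoids the finite
exceptional set of its four branches, (c) holds — the EX residual made explicit. -/
theorem condC_of_displays (hHsA : ∀ i, Hsieh2014mu_ThmA (N.lineA i))
    (hHsB : ∀ i, Hsieh2014mu_ThmA (N.lineB i))
    (hBHA : ∀ i, BurungaleHida2017_ThmB (N.lineA i))
    (hBHB : ∀ i, BurungaleHida2017_ThmB (N.lineB i))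
    (hIntA : ∀ i, Hsieh2014mu_Interp1_1 (N.lineA i))
    (hIntB : ∀ i, Hsieh2014mu_Interp1_1 (N.lineB i))
    (hkA : ∀ i, KernelHyps (N.lineA i)) (hkB : ∀ i, KernelHyps (N.lineB i)) :
    ∃ Z : Set Ξ, Z.Finite ∧ ∀ ν ∉ Z, (N.D ν).condC :=
  N.condC_of_notMem (fun i => hyps_of (hHsA i) (hBHA i) (hIntA i) (hkA i))
    (fun i => hyps_of (hHsB i) (hBHB i) (hIntB i) (hkB i))

/-- N5 FOR SOME TWIST OF THE DATUM FROM THE DISPLAYS ALONE (the family form, §N5.5(g) + §G):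
Theorem 5.6 on `sides`, N5.L1 / (a) / (b) for every member, the three §G displays on the four
branches, the kernel-side hypotheses, and Ξ_𝔭 infinite give N5 for the datum re-twisted to a good ν. -/
theorem N5_main_exists (hΞ : (Set.univ : Set Ξ).Infinite) (hT : BFGYYZ2025_Thm5_6 (sides N))
    (hL : ∀ ν, (N.D ν).A.levelReduction ∧ (N.D ν).B.levelReduction)
    (ha : ∀ ν, (N.D ν).A.condA ∧ (N.D ν).B.condA)
    (hb : ∀ ν, (N.D ν).A.condB ∧ (N.D ν).B.condB)
    (hHsA : ∀ i, Hsieh2014mu_ThmA (N.lineA i)) (hHsB : ∀ i, Hsieh2014mu_ThmA (N.lineB i))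
    (hBHA : ∀ i, BurungaleHida2017_ThmB (N.lineA i))
    (hBHB : ∀ i, BurungaleHida2017_ThmB (N.lineB i))
    (hIntA : ∀ i, Hsieh2014mu_Interp1_1 (N.lineA i))
    (hIntB : ∀ i, Hsieh2014mu_Interp1_1 (N.lineB i))
    (hkA : ∀ i, KernelHyps (N.lineA i)) (hkB : ∀ i, KernelHyps (N.lineB i)) :
    ∃ ν, (N.withTwist ν).N5 :=
  N.exists_N5 hΞ
    (fun ν => ⟨hT _ (A_mem_sides N ν), hT _ (B_mem_sides N ν)⟩) hL ha hb
    (fun i => hyps_of (hHsA i) (hBHA i) (hIntA i) (hkA i))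
    (fun i => hyps_of (hHsB i) (hBHB i) (hIntB i) (hkB i))

end Summit.Ventures.HodgeRepro2.T6.N5Main
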